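import Summits.QuantumFields.BalabanUV.Beta.D1BFx.GluonLocalNdlLetters
import Summits.QuantumFields.BalabanUV.Beta.D1BFx.GluonLocalProjWord
import Summits.QuantumFields.BalabanUV.Beta.D1BFx.NeedleProjNdlRow

/-!
# `BalabanUV.Beta.D1BFx.GluonLocalNdlWord` — road «BF-x» for binder row D1, slot (K), END row `hGrp gN`, «GN-Q» part 1: THE `SbT ⊗ ndl` WORD OF THE GLUON NEEDLE ROW
# T₁ AT ONE `(b, w)` — frame × letters: `|word(b,w)| ≤ K·((KΦ′c₂·Σ_s|qJet_b s|E₂(b+w−s))·(KN+KN′) + (KΦc₁·Σ_s|qJet_b s|E₁(b+w−s))·KN′)` (abstract letters;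
# the (1.22) sum and the piece `|cellSum n a SbT (ndlPiece n a (cQ n)) μ ν| ≤ C_Q` are part 2, `GluonLocalNdlRow`), on the OWNER's frame `LocalVertexForm.exists_SbT_outer_bound`

HONEST DEPENDENCY (cell records, verbatim): «continuum YM on T⁴ ⇐ BetaPertH ∧ nine spine estimates (0/9 proved); BetaPertH ⇐ (D1) ∧ (D4) ∧
CAP+tail; G-an2-4 gates asym, D1 and NE2/3/4.»  HONEST FRAMING (cell contract, verbatim): «discharging `BetaPertH` makes Bałaban's UV stability
UNCONDITIONAL — a real constructive-QFT result; it is NOT the continuum limit and NOT the Clay problem.»  THIS MODULE DISCHARGES NOTHING of the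
wall: [folklore] counting BY NAME on the owner's frame `LocalVertexForm.exists_SbT_outer_bound` (absolute `K`, `R`) and window shifts `GluonLocalProjWord.profile_window`,
the owner's `NeedleNdlShape.ndlPiece_eq_outer` ∕ `locV_ndlRow` ∕ `locV_combinedColumn` and column letters `NeedleColumnLetters.exists_applyK_gradC_le` ∕ `abs_gradC_le` ∕
`applyKT_eq_applyK_of_symm`, this seat's `NeedleNdlProjLetters.exists_applyK_grad_row_le`, `GluonLocalNdlLetters.exists_applyK_grad_row_diff_le` ∕ `exists_applyK_gradC_diff_le`
and `NeedleProjNdlRow.abs_weight_le_of_mem_B` ∕ `sum_resSite_needle_weight_le` (the base-average census over M7), leaf-04-g9's damped moments and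
`LatticeHLSPairing.abs_fullSum_le_of_abs_sum_le`, `SectorRecut.exists_biLoc_SbT`, `RankOneBubble.bubble_outer_sub_right`.  No `def`, no `def … : Prop`, nothing cited,
0 sorry; the printed statements are HYPOTHESES by name.  Root-level binders hW ∕ hR-sockets ∕ hSX-socket ∕ D1Tel ∕ D1Rep — 0 discharged; (K) NOT closed (T₁ pieces: P
(owner) + Q̇ (this file); K open; T₂ mirrors after the transposed frame); NOT D1, NOT `BetaPertH`, NOT continuum, NOT Clay.

ABSOLUTE RULE (cell charter, verbatim): «No internally-minted statement may enter as a cited fact. Every hypothesis is either kernel-proved in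
this package or a verbatim quotation of a PUBLISHED theorem with page reference. The manuscript(s) under audit are NOT citable for their own
disputed steps — they are the thing under adjudication; programme-internal (2001/route/tribunal) claims are never citable.»

WHY (owner claim table «GN-CELLS» v0.2, row «T₁∕T₂ K-piece, Q̇-piece»; l.31129 «GN-Q … first refusal leaf-01»; MINE l.31184).  THE COUNT.  The word at `(b, w)` is
`−½·bubble Ga (SbT μ (b+w)) (ndlPiece ν b)` and `ndlPiece ν b = ∇C_b ⊗ ∇ρ_b − ∇ρ_b ⊗ ∇C_b` (`ndlPiece_eq_outer`): two rank-one terms, each bounded by the frame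
`K·(Φ₁Γ₀ + Φ₀Γ₁ + Φ₁Γ₁)` from the window letters of its two ends around the vertex `u = b + w` (radius `R`).  The needle end `Ga∇ρ_b` has `Φ₀ = (kΦ∕n²)·c₁·Σ_s|qJet_b s|E₁(u−s)`,
`Φ₁ = (kΦ′∕n²)·c₂·Σ_s|qJet_b s|E₂(u−s)` (`E_p(v) = e^{−(ε∕n)‖v‖}∕nrm(v)^p`, window shift `c_p = e^{εR}(R+1)^p`); the column end `Ga∇C_b` has the sups `Γ₀ = kN·C₁·n`, `Γ₁ = kN′·C₁`
(`C₁ = cQ₀·cPPs + cPs`).  The three products are `Σ_s|qJet_b s|·[n⁻¹E₂ + n⁻²E₁ + n⁻²E₂](u−s)` up to constants; the (1.22) sum has NO needle weight under it (the needle sits at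
the base): `|w_μw_ν| ≤ 2‖u−s‖² + 2n²` and the damped moments give `Σ_w|w_μw_ν|E₂ ≍ n⁴`, `Σ_w|w_μw_ν|E₁ ≍ n⁵`, so ONE base site costs `q_b·n³·G₀` (`q_b = Σ_s|qJet_b s|`), and the base
average pays: `n⁻⁴·Σ_{b∈image resSite} q_b ≤ (n−1)·n⁻⁴` (M7) ⇒ `((n−1)∕n)·G₀ ≤ G₀`.  n⁰ with NO cancellation (an3 predicted n⁻¹ for this piece; n⁰ is what `hn` needs).

CONTENT (`a > 0`, `n ≥ 1`).
* §1 [folklore] **`abs_locNdl_word_le`** — pointwise, from an abstract frame `K, R` and abstract letters `KΦ`, `KΦ′` (needle-weighted, damped), `KN`, `KN′` (sups).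
NOT HERE (honest): the (1.22) sum and the piece (part 2 `GluonLocalNdlRow`); the K-piece «GN-K»; the T₂ mirrors (owner's transposed frame).
Unit `b2b-balaban-beta-d1-formalise-leaf-01` (gen 15), D1 formalisation swarm LEAF PROVER 01 on cross-road kernel duty; `LEAVES-BFx.md` row (N) «GN-Q» part 1.
-/

noncomputable section

namespace Summit.QuantumFields.BalabanUV.Beta.D1BFx.GluonLocalNdlWord

open Finset
open scoped BigOperators
open Literature.MathematicalPhysics.QuantumFieldTheory.Balaban1983to89
open Literature.MathematicalPhysics.QuantumFieldTheory.Balaban1983to89.Beta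
open B12Sec2to5 (l1 l1_nonneg)
open B4Sect5Proof (latticeConst latticeConst_nonneg)
open B6QGQLower276 (X e blk B mem_B)
open B6QGQDecay237 (card_B)
open ExpKernelCalculus (Site MKer Decays bubble summable_exp_shift summable_exp_shift')
open DyadicShell (Pt toReal toReal_apply)
open WindowIdentification (fullSum)
open DressedMomentNormalisation (resSite)
open AffineAveraging (unitVec)
open VectorTailsLoc (fam kfam)
open Beta.PoissonInterior (nrm nrm_pos one_le_nrm nrm_neg supNorm_le_nrm)
open Summit.QuantumFields.BalabanUV.Beta.TameKernelCalculus (Spr Loc)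
open Summit.QuantumFields.BalabanUV.Beta.D1BFx.PackedKernelSplit (biBubble bubble_eq_biBubble)
open Summit.QuantumFields.BalabanUV.Beta.D1BFx.FineHessianSectors (biBubbleTable biBubbleTable_apply)
open Summit.QuantumFields.BalabanUV.Beta.D1BFx.RProjector (Pgt kerP deltaPP deltaP deltaPP_pos deltaP_pos)
open Summit.QuantumFields.BalabanUV.Beta.D1BFx.ProjectorSupNorm (cPPs cPs cPPs_nonneg cPs_nonneg)
open Summit.QuantumFields.BalabanUV.Beta.D1BFx.GluonLeg (Ga Ga_apply Ga_symm)
open Summit.QuantumFields.BalabanUV.Beta.D1BFx.GluonLegTails (spr_Ga_of_prop12)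
open Summit.QuantumFields.BalabanUV.Beta.D1BFx.FrozenLegTails (nOf MOf hn1)
open Summit.QuantumFields.BalabanUV.Beta.D1BFx.GhostLeg (cast_pred_add_one)
open Summit.QuantumFields.BalabanUV.Beta.D1BFx.GhostStencil (qJet)
open Summit.QuantumFields.BalabanUV.Beta.D1BFx.SectorRecut (SbT exists_biLoc_SbT)
open Summit.QuantumFields.BalabanUV.Beta.D1BFx.GluonNeedleSplit (ndlPiece)
open Summit.QuantumFields.BalabanUV.Beta.D1BFx.GluonNeedleGlue (cellSum cellSum_def)
open Summit.QuantumFields.BalabanUV.Beta.D1BFx.RankOneBubble (outer applyK applyKT pairing applyK_apply applyKT_apply bubble_outer_sub_right LocV)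
open Summit.QuantumFields.BalabanUV.Beta.D1BFx.RankOneBubbleJets (grad grad_apply locV_grad_of_locV)
open Summit.QuantumFields.BalabanUV.Beta.D1BFx.NeedlePotentialLetters (ndlRow abs_ndlRow_diff_le)
open Summit.QuantumFields.BalabanUV.Beta.D1BFx.RColumnBlockMass (dR cRd dR_pos cRd_nonneg)
open Summit.QuantumFields.BalabanUV.Beta.D1BFx.NeedleNdlShape (ndlPiece_eq_outer locV_ndlRow locV_combinedColumn)
open Summit.QuantumFields.BalabanUV.Beta.D1BFx.NeedleColumnLetters (applyKT_eq_applyK_of_symm abs_gradC_le exists_applyK_gradC_le)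
open Summit.QuantumFields.BalabanUV.Beta.D1BFx.NeedleNdlProjLetters (exists_applyK_grad_row_le)
open Summit.QuantumFields.BalabanUV.Beta.D1BFx.GluonLocalNdlLetters (exists_applyK_grad_row_diff_le exists_applyK_gradC_diff_le)
open Summit.QuantumFields.BalabanUV.Beta.D1BFx.NeedleProjNdlRow (abs_weight_le_of_mem_B sum_resSite_needle_weight_le)
open Summit.QuantumFields.BalabanUV.Beta.D1BFx.GluonLocalProjWord (profile_window)
open Summit.QuantumFields.BalabanUV.Beta.D1BFx.LatticeHLSProfiles (supNorm_dyadic)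
open Summit.QuantumFields.BalabanUV.Beta.D1BFx.LatticeHLSPairing (abs_fullSum_le_of_abs_sum_le)
open Summit.QuantumFields.BalabanUV.Beta.D1BFx.LocalVertexForm (exists_SbT_outer_bound)

variable (n : ℕ) [NeZero n] (a : ℝ)

/-! ## §1 The `SbT ⊗ ndl` word at one `(b, w)`: frame × letters -/

/-- [folklore] **THE `SbT ⊗ ndl` WORD AT ONE `(b, w)`** from an abstract frame (`K`, `R`, the conclusion of `LocalVertexForm.exists_SbT_outer_bound`) and abstract
letters: the needle end's damped letters `KΦ` (degree 1), `KΦ′` (degree 2, unit difference) — needle weights of the BASE bond inside — and the column end's sups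
`KN`, `KN′`: `|biBubbleTable Ga Ga SbT ndl μ ν (b+w) b| ≤ K·((KΦ′·c₂·Σ_{s∈B(blk b)}|qJet_b s|·E₂(b+w−s))·(KN + KN′) + (KΦ·c₁·Σ_s|qJet_b s|·E₁(b+w−s))·KN′)`,
`E_p(v) = e^{−(ε∕n)‖v‖}∕nrm(v)^p`, `c_p = e^{εR}(R+1)^p` (the window shift). -/
theorem abs_locNdl_word_le (ha : 0 < a) (hA : Spr (Ga n a)) {K : ℝ} {R : ℕ}
    (hframe : ∀ (κ : Fin 4) (u : Pt) (A B : MKer 4 (Fin 4)) (φ ψ : Pt → Fin 4 → ℝ),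
      (∀ (s : Pt) (g : Fin 4), Summable fun x : Pt => ∑ a', ψ x a' * A x s a' g) →
      ∀ (Φ₀ Φ₁ Γ₀ Γ₁ : ℝ), 0 ≤ Φ₀ → 0 ≤ Φ₁ → 0 ≤ Γ₀ → 0 ≤ Γ₁ →
      (∀ (q : Pt) (g : Fin 4), DyadicShell.supNorm (q - u) ≤ R → |applyKT ψ A q g| ≤ Φ₀) →
      (∀ (q : Pt) (g : Fin 4) (i : Fin 4), DyadicShell.supNorm (q - u) ≤ R → |applyKT ψ A (q + unitVec i) g - applyKT ψ A q g| ≤ Φ₁) →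
      (∀ (q : Pt) (f : Fin 4), DyadicShell.supNorm (q - u) ≤ R → |applyK B φ q f| ≤ Γ₀) →
      (∀ (q : Pt) (f : Fin 4) (i : Fin 4), DyadicShell.supNorm (q - u) ≤ R → |applyK B φ (q + unitVec i) f - applyK B φ q f| ≤ Γ₁) →
      |biBubble A (SbT κ u) B (outer φ ψ)| ≤ K * (Φ₁ * Γ₀ + Φ₀ * Γ₁ + Φ₁ * Γ₁))
    {cQ KΦ KΦ' KN KN' ε : ℝ} (hKΦ : 0 ≤ KΦ) (hKΦ' : 0 ≤ KΦ') (hKN : 0 ≤ KN) (hKN' : 0 ≤ KN') (hε : 0 < ε)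
    (hΦ : ∀ (κ : Fin 4) (u x : Pt) (α : Fin 4), |applyK (Ga n a) (grad (ndlRow n a κ u)) x α|
      ≤ KΦ * ∑ s ∈ B (n - 1) (blk (n - 1) u), |qJet n κ u (blk (n - 1) u) s|
          * (Real.exp (-(ε / n) * PoissonInterior.supNorm (d := 4) (x - s)) / nrm (x - s) ^ 1))
    (hΦ' : ∀ (κ : Fin 4) (u x : Pt) (α i : Fin 4), |applyK (Ga n a) (grad (ndlRow n a κ u)) (x + unitVec i) α - applyK (Ga n a) (grad (ndlRow n a κ u)) x α|
      ≤ KΦ' * ∑ s ∈ B (n - 1) (blk (n - 1) u), |qJet n κ u (blk (n - 1) u) s|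
          * (Real.exp (-(ε / n) * PoissonInterior.supNorm (d := 4) (x - s)) / nrm (x - s) ^ 2))
    (hN : ∀ (u x : Pt) (α : Fin 4), |applyK (Ga n a)
        (grad (fun q => cQ * (∑ z ∈ B (n - 1) (blk (n - 1) u), Pgt n a z q () ()) - kerP (d := 4) (n - 1) a q (blk (n - 1) u))) x α| ≤ KN)
    (hN' : ∀ (u x : Pt) (α i : Fin 4), |applyK (Ga n a)
        (grad (fun q => cQ * (∑ z ∈ B (n - 1) (blk (n - 1) u), Pgt n a z q () ()) - kerP (d := 4) (n - 1) a q (blk (n - 1) u))) (x + unitVec i) α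
        - applyK (Ga n a) (grad (fun q => cQ * (∑ z ∈ B (n - 1) (blk (n - 1) u), Pgt n a z q () ()) - kerP (d := 4) (n - 1) a q (blk (n - 1) u))) x α|
        ≤ KN')
    (μ ν : Fin 4) (b w : Pt) :
    |biBubbleTable (Ga n a) (Ga n a) SbT (ndlPiece n a cQ) μ ν (b + w) b|
      ≤ K * ((KΦ' * (Real.exp (ε * R) * ((R : ℝ) + 1) ^ 2) * ∑ s ∈ B (n - 1) (blk (n - 1) b), |qJet n ν b (blk (n - 1) b) s| *
            (Real.exp (-(ε / n) * PoissonInterior.supNorm (d := 4) (b + w - s)) / nrm (b + w - s) ^ 2)) * (KN + KN')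
          + (KΦ * (Real.exp (ε * R) * ((R : ℝ) + 1) ^ 1) * ∑ s ∈ B (n - 1) (blk (n - 1) b), |qJet n ν b (blk (n - 1) b) s| *
            (Real.exp (-(ε / n) * PoissonInterior.supNorm (d := 4) (b + w - s)) / nrm (b + w - s) ^ 1)) * KN') := by
  have hn1 : 1 ≤ n := NeZero.one_le
  have hn : (0 : ℝ) < n := by exact_mod_cast Nat.pos_of_ne_zero (NeZero.ne n)
  set m : ℕ := n - 1 with hm
  set u : Pt := b + w with hu
  set Cf : Pt → ℝ := fun q => cQ * (∑ z ∈ B m (blk m b), Pgt n a z q () ()) - kerP (d := 4) m a q (blk m b) with hCf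
  set Wq : Pt → ℝ := fun s => |qJet n ν b (blk m b) s| with hWq
  set E₁ : Pt → ℝ := fun s => Real.exp (-(ε / n) * PoissonInterior.supNorm (d := 4) (b + w - s)) / nrm (b + w - s) ^ 1 with hE₁
  set E₂ : Pt → ℝ := fun s => Real.exp (-(ε / n) * PoissonInterior.supNorm (d := 4) (b + w - s)) / nrm (b + w - s) ^ 2 with hE₂
  set c₁ : ℝ := Real.exp (ε * R) * ((R : ℝ) + 1) ^ 1 with hc₁
  set c₂ : ℝ := Real.exp (ε * R) * ((R : ℝ) + 1) ^ 2 with hc₂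
  -- the window numbers of the needle end
  set Φ0 : ℝ := KΦ * c₁ * ∑ s ∈ B m (blk m b), Wq s * E₁ s with hΦ0
  set Φ1 : ℝ := KΦ' * c₂ * ∑ s ∈ B m (blk m b), Wq s * E₂ s with hΦ1
  have hS₁0 : 0 ≤ ∑ s ∈ B m (blk m b), Wq s * E₁ s :=
    Finset.sum_nonneg fun s _ => mul_nonneg (abs_nonneg _) (div_nonneg (Real.exp_pos _).le (pow_nonneg (nrm_pos _).le 1))
  have hS₂0 : 0 ≤ ∑ s ∈ B m (blk m b), Wq s * E₂ s :=
    Finset.sum_nonneg fun s _ => mul_nonneg (abs_nonneg _) (div_nonneg (Real.exp_pos _).le (pow_nonneg (nrm_pos _).le 2))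
  have hΦ0pos : 0 ≤ Φ0 := by positivity
  have hΦ1pos : 0 ≤ Φ1 := by positivity
  -- window bookkeeping
  have hwin : ∀ q : Pt, DyadicShell.supNorm (q - u) ≤ R → PoissonInterior.supNorm (d := 4) (q - u) ≤ R := fun q hq => by rwa [supNorm_dyadic] at hq
  have hqs : ∀ q s : Pt, q - s = (b + w - s) + (q - u) := fun q s => by rw [hu]; abel
  have hwΦ0 : ∀ (q : Pt) (g : Fin 4), DyadicShell.supNorm (q - u) ≤ R → |applyK (Ga n a) (grad (ndlRow n a ν b)) q g| ≤ Φ0 := by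
    intro q g hq
    refine (hΦ ν b q g).trans ?_
    have hs : ∀ s ∈ B m (blk m b), Wq s * (Real.exp (-(ε / n) * PoissonInterior.supNorm (d := 4) (q - s)) / nrm (q - s) ^ 1) ≤ c₁ * (Wq s * E₁ s) := by
      intro s _
      have h := profile_window (k := Wq s) (abs_nonneg _) hε.le hn1 1 (w := b + w - s) (hwin q hq)
      rw [← hqs q s] at h
      calc Wq s * (Real.exp (-(ε / n) * PoissonInterior.supNorm (d := 4) (q - s)) / nrm (q - s) ^ 1)
          = Wq s * Real.exp (-(ε / n) * PoissonInterior.supNorm (d := 4) (q - s)) / nrm (q - s) ^ 1 := by ring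
        _ ≤ Wq s * (Real.exp (ε * R) * ((R : ℝ) + 1) ^ 1) * (Real.exp (-(ε / n) * PoissonInterior.supNorm (d := 4) (b + w - s)) / nrm (b + w - s) ^ 1) := h
        _ = c₁ * (Wq s * E₁ s) := by rw [hc₁, hE₁]; ring
    calc KΦ * ∑ s ∈ B m (blk m b), Wq s * (Real.exp (-(ε / n) * PoissonInterior.supNorm (d := 4) (q - s)) / nrm (q - s) ^ 1)
        ≤ KΦ * ∑ s ∈ B m (blk m b), c₁ * (Wq s * E₁ s) := mul_le_mul_of_nonneg_left (Finset.sum_le_sum hs) hKΦ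
      _ = Φ0 := by rw [hΦ0, ← Finset.mul_sum]; ring
  have hwΦ1 : ∀ (q : Pt) (g i : Fin 4), DyadicShell.supNorm (q - u) ≤ R →
      |applyK (Ga n a) (grad (ndlRow n a ν b)) (q + unitVec i) g - applyK (Ga n a) (grad (ndlRow n a ν b)) q g| ≤ Φ1 := by
    intro q g i hq
    refine (hΦ' ν b q g i).trans ?_
    have hs : ∀ s ∈ B m (blk m b), Wq s * (Real.exp (-(ε / n) * PoissonInterior.supNorm (d := 4) (q - s)) / nrm (q - s) ^ 2) ≤ c₂ * (Wq s * E₂ s) := by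
      intro s _
      have h := profile_window (k := Wq s) (abs_nonneg _) hε.le hn1 2 (w := b + w - s) (hwin q hq)
      rw [← hqs q s] at h
      calc Wq s * (Real.exp (-(ε / n) * PoissonInterior.supNorm (d := 4) (q - s)) / nrm (q - s) ^ 2)
          = Wq s * Real.exp (-(ε / n) * PoissonInterior.supNorm (d := 4) (q - s)) / nrm (q - s) ^ 2 := by ring
        _ ≤ Wq s * (Real.exp (ε * R) * ((R : ℝ) + 1) ^ 2) * (Real.exp (-(ε / n) * PoissonInterior.supNorm (d := 4) (b + w - s)) / nrm (b + w - s) ^ 2) := h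
        _ = c₂ * (Wq s * E₂ s) := by rw [hc₂, hE₂]; ring
    calc KΦ' * ∑ s ∈ B m (blk m b), Wq s * (Real.exp (-(ε / n) * PoissonInterior.supNorm (d := 4) (q - s)) / nrm (q - s) ^ 2)
        ≤ KΦ' * ∑ s ∈ B m (blk m b), c₂ * (Wq s * E₂ s) := mul_le_mul_of_nonneg_left (Finset.sum_le_sum hs) hKΦ'
      _ = Φ1 := by rw [hΦ1, ← Finset.mul_sum]; ring
  -- localisation data and the split of `ndlPiece`
  obtain ⟨Cs, δs, hδs, hS⟩ := exists_biLoc_SbT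
  have hLocS : Loc (SbT μ u) := ⟨u, u, Cs, δs, hδs, hS μ u⟩
  have hLr : LocV (grad (ndlRow n a ν b)) := locV_grad_of_locV (locV_ndlRow n a ν b ha)
  have hLc : LocV (grad Cf) := locV_grad_of_locV (locV_combinedColumn n a cQ b ha)
  have hword : biBubbleTable (Ga n a) (Ga n a) SbT (ndlPiece n a cQ) μ ν (b + w) b =
      -(1 / 2 : ℝ) * (bubble (Ga n a) (SbT μ u) (outer (grad Cf) (grad (ndlRow n a ν b)))
        - bubble (Ga n a) (SbT μ u) (outer (grad (ndlRow n a ν b)) (grad Cf))) := by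
    rw [biBubbleTable_apply, ndlPiece_eq_outer n a cQ ν b ha, ← bubble_eq_biBubble, ← hu, bubble_outer_sub_right hA hLocS hLc hLr hLr hLc]
  -- summability of the two row ends (bounded bond functions against the spread leg)
  have hsumψ : ∀ {ψ : Pt → Fin 4 → ℝ} {M : ℝ}, (∀ y c, |ψ y c| ≤ M) → ∀ (s : Pt) (g : Fin 4), Summable fun x : Pt => ∑ a', ψ x a' * Ga n a x s a' g := by
    intro ψ M hM s g
    obtain ⟨C, δ', hδ', hGa⟩ := hA
    have hC : 0 ≤ C := hGa.nonneg g
    have hM0 : 0 ≤ M := (abs_nonneg _).trans (hM s g)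
    refine Summable.of_norm_bounded (g := fun x => ∑ _a' : Fin 4, M * (C * Real.exp (-δ' * l1 (x - s)))) ?_ fun x => ?_
    · exact summable_sum fun a' _ => ((summable_exp_shift' hδ' s).mul_left C).mul_left M
    · rw [Real.norm_eq_abs]
      refine (Finset.abs_sum_le_sum_abs _ _).trans (Finset.sum_le_sum fun a' _ => ?_)
      rw [abs_mul]
      exact mul_le_mul (hM x a') (hGa x s a' g) (abs_nonneg _) hM0
  have hbr : ∀ (y : Pt) (c : Fin 4), |grad (ndlRow n a ν b) y c| ≤ ((n : ℝ) ^ 4)⁻¹ * (cRd a / n * 1) := fun y c => by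
    rw [grad_apply]
    refine (abs_ndlRow_diff_le n ν b ha y c).trans (mul_le_mul_of_nonneg_left (mul_le_mul_of_nonneg_left ?_ (div_nonneg (cRd_nonneg ha) hn.le))
      (by positivity))
    rw [Real.exp_le_one_iff]; have : 0 ≤ dR a * dist (blk m y) (blk m b) := by have := dR_pos (a := a) ha; positivity
    linarith
  have hbc : ∀ (y : Pt) (c : Fin 4), |grad Cf y c| ≤ (|cQ| * cPPs 4 a + cPs 4 a) / (n : ℝ) := fun y c => by
    refine (abs_gradC_le a ha n cQ b y c).trans (mul_le_of_le_one_right (by have := cPPs_nonneg 4 ha; have := cPs_nonneg 4 ha; positivity) ?_)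
    rw [Real.exp_le_one_iff]
    have : 0 ≤ min (deltaPP 4 a) (deltaP 4 a) * dist (blk m b) (blk m y) := by
      have := deltaPP_pos 4 ha; have := deltaP_pos 4 ha; positivity
    linarith
  -- term 1: row end `∇ρ_b`, column end `∇C_b`
  have ht1 : |bubble (Ga n a) (SbT μ u) (outer (grad Cf) (grad (ndlRow n a ν b)))| ≤ K * (Φ1 * KN + Φ0 * KN' + Φ1 * KN') := by
    rw [bubble_eq_biBubble]
    refine hframe μ u (Ga n a) (Ga n a) (grad Cf) (grad (ndlRow n a ν b)) (hsumψ hbr) Φ0 Φ1 KN KN' hΦ0pos hΦ1pos hKN hKN'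
      (fun q g hq => ?_) (fun q g i hq => ?_) (fun q f _ => hN b q f) (fun q f i _ => hN' b q f i)
    · rw [applyKT_eq_applyK_of_symm a ha n]; exact hwΦ0 q g hq
    · rw [applyKT_eq_applyK_of_symm a ha n]; exact hwΦ1 q g i hq
  -- term 2: row end `∇C_b`, column end `∇ρ_b`
  have ht2 : |bubble (Ga n a) (SbT μ u) (outer (grad (ndlRow n a ν b)) (grad Cf))| ≤ K * (KN' * Φ0 + KN * Φ1 + KN' * Φ1) := by
    rw [bubble_eq_biBubble]
    refine hframe μ u (Ga n a) (Ga n a) (grad (ndlRow n a ν b)) (grad Cf) (hsumψ hbc) KN KN' Φ0 Φ1 hKN hKN' hΦ0pos hΦ1pos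
      (fun q g _ => ?_) (fun q g i _ => ?_) (fun q f hq => hwΦ0 q f hq) (fun q f i hq => hwΦ1 q f i hq)
    · rw [applyKT_eq_applyK_of_symm a ha n]; exact hN b q g
    · rw [applyKT_eq_applyK_of_symm a ha n]; exact hN' b q g i
  -- assemble
  rw [hword, abs_mul, show |(-(1 / 2 : ℝ))| = 1 / 2 by norm_num]
  have htri : |bubble (Ga n a) (SbT μ u) (outer (grad Cf) (grad (ndlRow n a ν b))) - bubble (Ga n a) (SbT μ u) (outer (grad (ndlRow n a ν b)) (grad Cf))|
      ≤ |bubble (Ga n a) (SbT μ u) (outer (grad Cf) (grad (ndlRow n a ν b)))| + |bubble (Ga n a) (SbT μ u) (outer (grad (ndlRow n a ν b)) (grad Cf))| :=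
    abs_sub _ _
  calc (1 / 2 : ℝ) * |bubble (Ga n a) (SbT μ u) (outer (grad Cf) (grad (ndlRow n a ν b)))
        - bubble (Ga n a) (SbT μ u) (outer (grad (ndlRow n a ν b)) (grad Cf))|
      ≤ (1 / 2 : ℝ) * (K * (Φ1 * KN + Φ0 * KN' + Φ1 * KN') + K * (KN' * Φ0 + KN * Φ1 + KN' * Φ1)) :=
        mul_le_mul_of_nonneg_left (htri.trans (add_le_add ht1 ht2)) (by norm_num)
    _ = K * (Φ1 * (KN + KN') + Φ0 * KN') := by ring
    _ = _ := by rw [hΦ0, hΦ1]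


end Summit.QuantumFields.BalabanUV.Beta.D1BFx.GluonLocalNdlWord

end
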